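import Summits.BirchSwinnertonDyer.Rank1Residual.X11a.PrintDischargeKimDeepTate
import Summits.BirchSwinnertonDyer.Rank1Residual.X11a.VisibilityRecordsNoRam
import Summits.BirchSwinnertonDyer.BirchSwinnertonDyer.Theorems.PrintX11aLowerHalfKimDeepRecord320045bh1
import Summits.BirchSwinnertonDyer.Rank1Residual.X11a.KimDeepRecords1
import HarnessLib

/-!
# Class X11a, SURJECTIVE leaf, the five Tamagawa-defect pairs at `p = 5` (`5 ∣ ∏ c_ℓ`, `#Ш_an = 25`):
# per-pair FLAG-FREE deep-Kurihara closures `BSDp W 5` through ONE door, no local datum — file 2 of 3: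
# `320045bh1`, `375440db1` (cell `bsd-print-x11a`, seat ty3 g10; Summits side of `TY3-CERTIFICATE-RECORDS.md` §17)

HONEST FRAMING (cell rule, verbatim): PARTITION currency only — a leaf counts when its class theorem is in
the kernel BY NAME; these are PER-PAIR closures (ACCOUNTING for the census desk), not a class theorem; the
crux `X11aLowerHalf` (item stmt-BirchSwinnertonDyer-19064) stays OPEN class-wide; nothing is booked by this
file and no label moves; BSD is not proved by any of this. THEOREMS ONLY (no `def`, no named fact, no
`sorry`, no instance/notation).

WHY. In referee A's book (state of record R1051, 2026-08-28T14:28Z) the `(5, X11a)` share of the open residue is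
28 classes: 23 non-surjective (closed per pair flag-free by `X11a/HeegnerClosureRecords1–4` and
`X11a/TamagawaClosureRecords1–7`, ty3 g9, offered) and exactly these FIVE surjective deep pairs. Each of the five
already has a deep Kurihara-number record in the tree (p1 g3/g4: `X11a/KimDeepRecords1.lean`,
`Theorems/PrintX11aLowerHalfKimDeepRecord{285660u,320045bh1,419120cq1,490960cp1}.lean`), but through THREE
different doors: the two SPLIT pairs `285660u1/u2`, `320045bh1` through the LITERAL fact
`Kim2026.rankZero_le_padicValNat_sha_of_kuriharaNumber_ne_zero` (registry flag `K26-(6)-shallow@t>0`, REF-AUDIT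
§F 19:25Z «LITERAL until re-pointed»), the three non-split pairs through the `(t0)` twin with a displayed `hns`.
The re-point asked for as TURNKEY T-ty1-B (ty2 g4, STATUS 2026-08-27T20:33:06Z) was never filed. This file files
it for all five classes uniformly: every pair goes through ty2's `ClassX11a.bsdp_of_kimDeep_mult` /
`ClassX11a.missingLowerBoundAt_of_kimDeep_mult` (`X11a/PrintDischargeKimDeepTate.lean` §4, p566955, REF PASS), whose
Kim binder is ty1's `Kim2026.rankZero_le_padicValNat_sha_of_kuriharaNumber_ne_zero_of_splitMultiplicative_or_localTorsionTrivial`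
(p565754; Kim's own `t = 0` on the multiplicative locus, AJM 148 §3.2.1 / Lemma 3.9 / Thm. 3.13 — REF g5 PASS «≤ print»,
flag-free) and which needs NO local datum (split ⟹ `inl`; non-split ⟹ `#E(ℚ₅)[5] = 1` in the kernel).

PER PAIR, three theorems (grammar of ty3 g9's `X11a/TamagawaClosureRecords*` / p1's records):
* `classX11a_k<label> (W) (hWeq) (hr) : ClassX11a W 5` — KERNEL atoms: `5 ∥ N` by `5 ∣ Δ ∧ 5 ∤ c₄` on the
  integral model; `E[5]` irreducible by a Frobenius witness `ℓ` (`#Ẽ(𝔽_ℓ)` by `countPoints`, the tree's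
  `card_*` theorem REUSED where it exists; `X² − a_ℓX + ℓ` root-free mod `5`, Mazur 1978 Prop. 6.3 (1)); **no (ram)
  prime in the kernel** (`VisibilityRecords.not_ram_of_intModel` on the displayed full factorisation of `Δ`: every
  `ℓ ∣ Δ` is `5`, or additive (`ℓ ∣ c₄`), or has `5 ∣ ord_ℓ Δ`) — p1's records carried `hnram` as a DISPLAYED binder.
* `mlb5_k<label>` — `MissingLowerBoundAt W 5` (crux-19064 currency at the pair) from the record's certificate through
  `ClassX11a.missingLowerBoundAt_of_kimDeep_mult`.
* `bsdp5_k<label>` — `BSDp W 5` (+ Wuthrich 2014 Prop. 21 `hWu` for the Euler half at surjective image) through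
  `ClassX11a.bsdp_of_kimDeep_mult`.
FACT binders (all print, none flagged): `hWu : sha_dvd_analyticSha` (Wuthrich 2014 Prop. 21), `hKimM` (Kim 2026 Thm. 1.8 (6)
with Kim's `t = 0`), `hϖ : realPeriodRat_eq_unit_mul_plusPeriod_of_multiplicative` (Greenberg–Vatsal 2000 Rem. 3.4 period
transfer at a multiplicative `p ≥ 5`), `hGZK`, `hmod`. DISPLAYED binders (= exactly p1's, minus `hnram`/`hns`): `hWeq`, `hr`,
`hsurj` (Cremona: no galrep code at `5`), `htam : ∏ c_ℓ = …`, the parametrisation datum `D` with `5 ∤ c_D` (optimal curve,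
`25 ∤ N`: Mazur Cor. 4.1; `285660u2` through its `3`-isogeny), `hn : n ∈ 𝒩₂`, `hcyc` (cyclic `Ẽ(𝔽_ℓ)[5]`), `ψ ↠ ℤ/25`, and the
certificate `hδ : kuriharaNumber D.f 25 n ψ ≠ 0` (the engines' `δ̃_n mod 25`, table below).

| pair | model | `N` | at `5` | `∏c`·`#Ш_an` | certificate | Frobenius witness | engines (cell rule: two before booking) |
|---|---|---|---|---|---|---|---|
| `285660u1` | `[0, 0, 0, -16938719127, -848533442942354]` | `285660 = 2²·3³·5·23²` | split | 30·25 (`c₅ = 5`) | `902651 = 401·2251`, δ̃ ≡ 5 (25) | `ℓ = 7`, `#Ẽ = 4` | kur2 j285778 (twisted-L/FFT, p1 g3) + M j287849 (exact eclib, p1 g4): 450000/450000 symbols identical (sha e20c00664c32171b…), δ̃ ≡ 5 (mod 25) |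
| `285660u2` | `[0, 0, 0, -16936624287, -848753813301066]` | `285660 = 2²·3³·5·23²` | split | 30·25 (`c₅ = 15`) | `902651 = 401·2251`, δ̃ ≡ 5 (25) | `ℓ = 7`, `#Ẽ = 4` | same newform as u1: kur2 j285778 + M j287849, δ̃ ≡ 5 (mod 25) |
| `320045bh1` | `[0, 1, 1, -600169720, -5659454700619]` | `320045 = 5·11²·23²` | split | 10·25 (`c₅ = 5`) | `38213551 = 4001·9551`, δ̃ ≡ 10 (25) | `ℓ = 3`, `#Ẽ = 6` | M j288451 (exact eclib, p1 g4) — SINGLE engine; δ̃ ≡ 10 (mod 25) |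
| `375440db1` | `[0, -1, 0, -20373516, -45774812020]` | `375440 = 2⁴·5·13·19²` | non-split | 10·25 (`c₅ = 2`) | `1887751 = 1301·1451`, δ̃ ≡ 10 (25) | `ℓ = 7`, `#Ẽ = 4` | kur2 j285781 (p1 g3) + M j287849 (p1 g4): 942500/942500 symbols identical (sha 997069123c795753…), δ̃ ≡ 10 (mod 25) |
| `419120cq1` | `[0, 0, 0, -934673428, -29882525634052]` | `419120 = 2⁴·5·13²·31` | non-split | 20·25 (`c₅ = 1`) | `16160401 = 1901·8501`, δ̃ ≡ 5 (25) | `ℓ = 3`, `#Ẽ = 1` | M j288454 (exact eclib, p1 g4) — SINGLE engine; δ̃ ≡ 5 (mod 25) |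
| `490960cp1` | `[0, -1, 0, -1000022654136, -521532333619167664]` | `490960 = 2⁴·5·17·19²` | non-split | 20·25 (`c₅ = 1`) | `12031951 = 3251·3701`, δ̃ ≡ 10 (25) | `ℓ = 3`, `#Ẽ = 2` | M j288035 (exact eclib, p1 g4) — SINGLE engine; δ̃ ≡ 10 (mod 25) |

ENGINE STATUS (honest): `285660u1/u2` and `375440db1` are TWO-ENGINE (p1 g3 `kur2` twisted-L/FFT + p1 g4 engine M exact
eclib, byte-identical symbol tables; same seat lineage); `320045bh1`, `419120cq1`, `490960cp1` are SINGLE-ENGINE (M) with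
Hecke self-checks (REF-AUDIT §F/§G; REF T3: an independent engine at `n ~ 10⁷` is a streaming twisted-L run). A second-seat
engine is ty3 g10's kit programme (cell doc §17); this file is engine-neutral (the certificate is a displayed binder).

Beyond-print theorem: NO. References: [Kim2022StructureSelmer] C.-H. Kim, Amer. J. Math. 148 (2026) = arXiv:2203.12159,
Thm. 1.9 (6) (= journal Thm. 1.8 (6)), §1.5.1, §3.2.1, Lemma 3.9, Thm. 3.13; [Wuthrich2014] Prop. 21 (p. 400);
[GreenbergVatsal2000] Rem. 3.4; [Mazur1978] §6 Prop. 6.3 (1) (p. 153), Cor. 4.1; [SilvermanAEC2009] VII.1 Rem. 1.1,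
VII.5 Prop. 5.1, VII.6.1; [Kraus1989] Prop. 1–2; [Miller2011LMS] Def. 1.1; [Cremona2006] Table 1; tree
`X11a/PrintDischargeKimDeepTate.lean` §4, `X11a/PrintDischargeKimDeep.lean`, `X11a/VisibilityRecordsNoRam.lean`,
`X11a/KimDeepRecords1.lean`, `Theorems/PrintX11aLowerHalfKimDeepRecord*.lean`; cell docs
`pub/bsd-print-x11a/TY3-CERTIFICATE-RECORDS.md` §16–§17, `P1-ROAD.md` §8, REF-AUDIT §F–§G.
-/

set_option autoImplicit false

noncomputable section

open scoped Classical

open WeierstrassCurve Literature.NumberTheory.EllipticCurves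
  Literature.NumberTheory.EllipticCurves.ModularForms
  Literature.NumberTheory.EllipticCurves.Rank1Residual
  Literature.NumberTheory.EllipticCurves.Rank1Residual.Typed
  Literature.NumberTheory.EllipticCurves.Rank1Residual.X11RankOneCertificates
  Literature.NumberTheory.EllipticCurves.Wuthrich2014
  NumberField IsDedekindDomain Rat.HeightOneSpectrum
  Summit.BirchSwinnertonDyer.BirchSwinnertonDyer.Rank1Residual.IntModel
  Summit.BirchSwinnertonDyer.BirchSwinnertonDyer.Rank1Residual.X11RankOne
  Summit.BirchSwinnertonDyer.Rank1Residual.Supersingular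
  Summit.BirchSwinnertonDyer.Rank1Residual.X11a.VisibilityRecords

namespace Summit.BirchSwinnertonDyer.Rank1Residual.X11a.KimDeepClosures

open Summit.BirchSwinnertonDyer.Rank1Residual

/-! ### `320045bh1 @ 5` (`N = 320045 = 5·11²·23²`, `ρ̄_{E,5}` onto, SPLIT multiplicative at `5`, `∏ c_ℓ = 10` (`c₅ = 5`),
`#E(ℚ)_tors = 1`, `#Ш_an = 25`, `L(E,1)/Ω = 250`; `|Δ| = 5⁵·11⁴·23⁹`) -/
/-- **`320045bh1 = [0, 1, 1, -600169720, -5659454700619]` lies in class X11a at `5`, in the KERNEL up to `r_an = 0`**: `5 ∥ N`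
(`5 ∣ Δ`, `5 ∤ c₄` on the integral model; Silverman VII.5.1 (b)); `E[5]` irreducible by the Frobenius witness
`ℓ = 3` (`#Ẽ(𝔽_3) = 6`, `a_3 = -2`, `X² − a_3X + 3` root-free mod `5`; tree `KimDeep.card_c320045bh1_3` REUSED; Mazur 1978
Prop. 6.3 (1)); **no (ram) prime** from the displayed factorisation `|Δ| = 5⁵·11⁴·23⁹` decided in the kernel
(`not_ram_of_intModel`: `5 = p`, `11` additive (`11 ∣ c₄`), `23` additive (`23 ∣ c₄`)). Displayed: `hr` (`r_an = 0`, Cremona).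
[cite: SilvermanAEC2009, VII.5 Prop. 5.1] [cite: Mazur1978, §6 Prop. 6.3 (1) (p. 153)]
[cite: Cremona2006, Table 1 (Cremona label 320045bh1)] -/
theorem classX11a_k320045bh1 (W : WeierstrassCurve ℚ) [W.IsElliptic] [W.IsGloballyMinimal] [Fact (Nat.Prime 5)]
    (hWeq : W = ⟨0, 1, 1, -600169720, -5659454700619⟩) (hr : W.analyticRank = 0) : ClassX11a W 5 := by
  haveI : Fact (Nat.Prime 3) := ⟨by norm_num⟩
  haveI : Fact (Nat.Prime 11) := ⟨by norm_num⟩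
  haveI : Fact (Nat.Prime 23) := ⟨by norm_num⟩
  have hI : integralModelInt W = ⟨0, 1, 1, -600169720, -5659454700619⟩ := by
    subst hWeq; exact integralModelInt_eq_of_map_eq _ (map_mk_int 0 1 1 (-600169720) (-5659454700619))
  have hmult : Mult W 5 :=
    hasMultiplicativeReductionAtPrime_of_intModel hI 5 (by decide +kernel) (by decide +kernel)
  have hirr : Irr W 5 :=
    hasIrreducibleModPGaloisRep_of_intModel_of_noroot (hp := ⟨by norm_num⟩) (hℓ := ⟨by norm_num⟩)
      hI 5 3 (by norm_num) (by decide +kernel) Summit.BirchSwinnertonDyer.BirchSwinnertonDyer.Theorems.KimDeep.card_c320045bh1_3 (by decide)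
  have hnram : ¬ Ram W 5 := not_ram_of_intModel hI 5 [5, 11, 23] [5, 4, 9]
    (by intro q hq; simp only [List.mem_cons, List.mem_nil_iff, or_false] at hq
        rcases hq with rfl | rfl | rfl <;> norm_num) (by decide +kernel)
    (by intro ℓ hℓ; simp only [List.mem_cons, List.mem_nil_iff, or_false] at hℓ
        rcases hℓ with rfl | rfl | rfl
        · exact Or.inl rfl
        · exact Or.inr (Or.inl (by decide +kernel))
        · exact Or.inr (Or.inl (by decide +kernel)))
  exact ⟨hr, by decide, hmult, hirr, hnram⟩

/-- **`320045bh1 @ 5`: the LOWER half `ord₅ #Ш_an ≤ ord₅ #Ш`** (`Typed.MissingLowerBoundAt W 5`, the currency of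
crux `X11aLowerHalf` = item 19064 AT THIS PAIR) from the deep Kurihara certificate `δ̃_n ≡ 10 (mod 25)` at
`n = 38213551 = 4001·9551 ∈ 𝒩₂` (`#Ẽ(𝔽_4001) = 4000`, `#Ẽ(𝔽_9551) = 9675`, cyclic `5`-part), level `k = 2 ≤ ord₅ ∏ c_ℓ + 1`
(`∏ c_ℓ = 10`), through `ClassX11a.missingLowerBoundAt_of_kimDeep_mult` — Kim 2026 Thm. 1.8 (6) beyond the unit case with
Kim's own `t = 0` on the multiplicative locus (`hKimM`, flag-free), period transfer `hϖ`, GZK, modularity; NO local datum,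
NO `hns`, NO `hnram` (class atoms by `classX11a_k320045bh1`). Engines: M j288451 (exact eclib, p1 g4) — SINGLE engine; δ̃ ≡ 10 (mod 25). Supersedes for bookings:
`Theorems.KimDeep.bsdp5_c320045bh1 (p565936; literal door)`. PER PAIR; nothing booked by this file.
[cite: Kim2022StructureSelmer, Thm. 1.9 (6) (PDF p. 8), §1.5.1 (PDF p. 7), §3.2.1 (PDF p. 15), Thm. 3.13 (PDF p. 17)]
[cite: Mazur1978, §6 Prop. 6.3 (1) (p. 153) and Cor. 4.1] [cite: Miller2011LMS, Def. 1.1]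
[cite: Cremona2006, Table 1 (Cremona label 320045bh1)] -/
theorem mlb5_k320045bh1
    (hKimM : Kim2026.rankZero_le_padicValNat_sha_of_kuriharaNumber_ne_zero_of_splitMultiplicative_or_localTorsionTrivial)
    (hϖ : realPeriodRat_eq_unit_mul_plusPeriod_of_multiplicative)
    (hGZK : rank_eq_analyticRank_of_analyticRank_le_one) (hmod : hasEntireLFunction_rat)
    (W : WeierstrassCurve ℚ) [W.IsElliptic] [W.IsGloballyMinimal]
    (hWeq : W = ⟨0, 1, 1, -600169720, -5659454700619⟩) (hr : W.analyticRank = 0) (hsurj : Surj W 5)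
    (htam : W.tamagawaProduct = 10)
    {N : ℕ} [NeZero N] (D : ModularParametrizationData W N) (hc : ¬ (5 : ℤ) ∣ D.maninConstant)
    (hn : Kato.IsKolyvaginProduct W 5 2 38213551)
    (hcyc : ∀ (ℓ : ℕ) [Fact ℓ.Prime], ℓ ∣ 38213551 →
      Nat.card {P : ((WeierstrassCurve.integralModelInt W).map
          (Int.castRingHom (ZMod ℓ))).toAffine.Point // 5 • P = 0} ≤ 5)
    (ψ : (ℓ : ℕ) → (ZMod ℓ)ˣ →* Multiplicative (ZMod (5 ^ 2)))
    (hψ : ∀ ℓ ∈ (38213551 : ℕ).primeFactors, Function.Surjective (ψ ℓ))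
    (hδ : kuriharaNumber D.f (5 ^ 2) 38213551 ψ ≠ 0) : MissingLowerBoundAt W 5 := by
  haveI : Fact (Nat.Prime 5) := ⟨by norm_num⟩
  haveI : NeZero (38213551 : ℕ) := ⟨by norm_num⟩
  have hX : ClassX11a W 5 := classX11a_k320045bh1 W hWeq hr
  have hkc : 2 ≤ padicValNat 5 W.tamagawaProduct + 1 := by
    have h1 : 1 ≤ padicValNat 5 W.tamagawaProduct := by
      rw [htam]; exact one_le_padicValNat_of_dvd (by norm_num) (by norm_num)
    omega
  exact hX.missingLowerBoundAt_of_kimDeep_mult hKimM hϖ hGZK hmod le_rfl hsurj D hc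
    2 38213551 (by norm_num) hkc hn hcyc ψ hψ hδ

/-- **`BSD(320045bh1, 5)`** (`BSDp W 5`) from the same certificate: the lower half of `mlb5_k320045bh1` plus the Euler half at
surjective image (Wuthrich 2014 Prop. 21, `hWu`), through `ClassX11a.bsdp_of_kimDeep_mult`. Flag-free; PER PAIR;
nothing booked by this file. [cite: Wuthrich2014, Prop. 21 (p. 400)]
[cite: Kim2022StructureSelmer, Thm. 1.9 (6) (PDF p. 8), §3.2.1, Lemma 3.9, Thm. 3.13] [cite: Miller2011LMS, Def. 1.1]
[cite: Cremona2006, Table 1 (Cremona label 320045bh1)] -/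
theorem bsdp5_k320045bh1 (hWu : sha_dvd_analyticSha)
    (hKimM : Kim2026.rankZero_le_padicValNat_sha_of_kuriharaNumber_ne_zero_of_splitMultiplicative_or_localTorsionTrivial)
    (hϖ : realPeriodRat_eq_unit_mul_plusPeriod_of_multiplicative)
    (hGZK : rank_eq_analyticRank_of_analyticRank_le_one) (hmod : hasEntireLFunction_rat)
    (W : WeierstrassCurve ℚ) [W.IsElliptic] [W.IsGloballyMinimal]
    (hWeq : W = ⟨0, 1, 1, -600169720, -5659454700619⟩) (hr : W.analyticRank = 0) (hsurj : Surj W 5)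
    (htam : W.tamagawaProduct = 10)
    {N : ℕ} [NeZero N] (D : ModularParametrizationData W N) (hc : ¬ (5 : ℤ) ∣ D.maninConstant)
    (hn : Kato.IsKolyvaginProduct W 5 2 38213551)
    (hcyc : ∀ (ℓ : ℕ) [Fact ℓ.Prime], ℓ ∣ 38213551 →
      Nat.card {P : ((WeierstrassCurve.integralModelInt W).map
          (Int.castRingHom (ZMod ℓ))).toAffine.Point // 5 • P = 0} ≤ 5)
    (ψ : (ℓ : ℕ) → (ZMod ℓ)ˣ →* Multiplicative (ZMod (5 ^ 2)))
    (hψ : ∀ ℓ ∈ (38213551 : ℕ).primeFactors, Function.Surjective (ψ ℓ))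
    (hδ : kuriharaNumber D.f (5 ^ 2) 38213551 ψ ≠ 0) : BSDp W 5 := by
  haveI : Fact (Nat.Prime 5) := ⟨by norm_num⟩
  haveI : NeZero (38213551 : ℕ) := ⟨by norm_num⟩
  have hX : ClassX11a W 5 := classX11a_k320045bh1 W hWeq hr
  have hkc : 2 ≤ padicValNat 5 W.tamagawaProduct + 1 := by
    have h1 : 1 ≤ padicValNat 5 W.tamagawaProduct := by
      rw [htam]; exact one_le_padicValNat_of_dvd (by norm_num) (by norm_num)
    omega
  exact hX.bsdp_of_kimDeep_mult hWu hKimM hϖ hGZK hmod le_rfl hsurj D hc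
    2 38213551 (by norm_num) hkc hn hcyc ψ hψ hδ

/-! ### `375440db1 @ 5` (`N = 375440 = 2⁴·5·13·19²`, `ρ̄_{E,5}` onto, NON-split multiplicative at `5`, `∏ c_ℓ = 10` (`c₅ = 2`),
`#E(ℚ)_tors = 1`, `#Ш_an = 25`, `L(E,1)/Ω = 250`; `|Δ| = 2⁸·5⁴·13⁵·19¹⁰`) -/
/-- **`375440db1 = [0, -1, 0, -20373516, -45774812020]` lies in class X11a at `5`, in the KERNEL up to `r_an = 0`**: `5 ∥ N`
(`5 ∣ Δ`, `5 ∤ c₄` on the integral model; Silverman VII.5.1 (b)); `E[5]` irreducible by the Frobenius witness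
`ℓ = 7` (`#Ẽ(𝔽_7) = 4`, `a_7 = 4`, `X² − a_7X + 7` root-free mod `5`; tree `KimDeepRecords.card_c375440db1_7` REUSED; Mazur 1978
Prop. 6.3 (1)); **no (ram) prime** from the displayed factorisation `|Δ| = 2⁸·5⁴·13⁵·19¹⁰` decided in the kernel
(`not_ram_of_intModel`: `2` additive (`2 ∣ c₄`), `5 = p`, `13` multiplicative with `5 ∣ ord_13 Δ = 5`, `19` additive (`19 ∣ c₄`)). Displayed: `hr` (`r_an = 0`, Cremona).
[cite: SilvermanAEC2009, VII.5 Prop. 5.1] [cite: Mazur1978, §6 Prop. 6.3 (1) (p. 153)]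
[cite: Cremona2006, Table 1 (Cremona label 375440db1)] -/
theorem classX11a_k375440db1 (W : WeierstrassCurve ℚ) [W.IsElliptic] [W.IsGloballyMinimal] [Fact (Nat.Prime 5)]
    (hWeq : W = ⟨0, -1, 0, -20373516, -45774812020⟩) (hr : W.analyticRank = 0) : ClassX11a W 5 := by
  haveI : Fact (Nat.Prime 2) := ⟨by norm_num⟩
  haveI : Fact (Nat.Prime 7) := ⟨by norm_num⟩
  haveI : Fact (Nat.Prime 13) := ⟨by norm_num⟩
  haveI : Fact (Nat.Prime 19) := ⟨by norm_num⟩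
  have hI : integralModelInt W = ⟨0, -1, 0, -20373516, -45774812020⟩ := by
    subst hWeq; exact integralModelInt_eq_of_map_eq _ (map_mk_int 0 (-1) 0 (-20373516) (-45774812020))
  have hmult : Mult W 5 :=
    hasMultiplicativeReductionAtPrime_of_intModel hI 5 (by decide +kernel) (by decide +kernel)
  have hirr : Irr W 5 :=
    hasIrreducibleModPGaloisRep_of_intModel_of_noroot (hp := ⟨by norm_num⟩) (hℓ := ⟨by norm_num⟩)
      hI 5 7 (by norm_num) (by decide +kernel) Summit.BirchSwinnertonDyer.Rank1Residual.X11a.KimDeepRecords.card_c375440db1_7 (by decide)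
  have hnram : ¬ Ram W 5 := not_ram_of_intModel hI 5 [2, 5, 13, 19] [8, 4, 5, 10]
    (by intro q hq; simp only [List.mem_cons, List.mem_nil_iff, or_false] at hq
        rcases hq with rfl | rfl | rfl | rfl <;> norm_num) (by decide +kernel)
    (by intro ℓ hℓ; simp only [List.mem_cons, List.mem_nil_iff, or_false] at hℓ
        rcases hℓ with rfl | rfl | rfl | rfl
        · exact Or.inr (Or.inl (by decide +kernel))
        · exact Or.inl rfl
        · have hv : padicValInt 13 (⟨0, -1, 0, -20373516, -45774812020⟩ : WeierstrassCurve ℤ).Δ = 5 :=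
            padicValInt_eq_of_dvd_of_not_dvd 13 (by decide +kernel) (by decide +kernel)
          exact Or.inr (Or.inr (Int.natCast_dvd_natCast.mpr (Dvd.intro 1 (by omega))))
        · exact Or.inr (Or.inl (by decide +kernel)))
  exact ⟨hr, by decide, hmult, hirr, hnram⟩

/-- **`375440db1 @ 5`: the LOWER half `ord₅ #Ш_an ≤ ord₅ #Ш`** (`Typed.MissingLowerBoundAt W 5`, the currency of
crux `X11aLowerHalf` = item 19064 AT THIS PAIR) from the deep Kurihara certificate `δ̃_n ≡ 10 (mod 25)` at
`n = 1887751 = 1301·1451 ∈ 𝒩₂` (`#Ẽ(𝔽_1301) = 1325`, `#Ẽ(𝔽_1451) = 1425`, cyclic `5`-part), level `k = 2 ≤ ord₅ ∏ c_ℓ + 1`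
(`∏ c_ℓ = 10`), through `ClassX11a.missingLowerBoundAt_of_kimDeep_mult` — Kim 2026 Thm. 1.8 (6) beyond the unit case with
Kim's own `t = 0` on the multiplicative locus (`hKimM`, flag-free), period transfer `hϖ`, GZK, modularity; NO local datum,
NO `hns`, NO `hnram` (class atoms by `classX11a_k375440db1`). Engines: kur2 j285781 (p1 g3) + M j287849 (p1 g4): 942500/942500 symbols identical (sha 997069123c795753…), δ̃ ≡ 10 (mod 25). Supersedes for bookings:
`X11a.KimDeepRecords.bsdp5_c375440db1 (p555920; (t0) door `_of_localTorsionTrivial`, displayed `hns`)`. PER PAIR; nothing booked by this file.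
[cite: Kim2022StructureSelmer, Thm. 1.9 (6) (PDF p. 8), §1.5.1 (PDF p. 7), §3.2.1 (PDF p. 15), Thm. 3.13 (PDF p. 17)]
[cite: Mazur1978, §6 Prop. 6.3 (1) (p. 153) and Cor. 4.1] [cite: Miller2011LMS, Def. 1.1]
[cite: Cremona2006, Table 1 (Cremona label 375440db1)] -/
theorem mlb5_k375440db1
    (hKimM : Kim2026.rankZero_le_padicValNat_sha_of_kuriharaNumber_ne_zero_of_splitMultiplicative_or_localTorsionTrivial)
    (hϖ : realPeriodRat_eq_unit_mul_plusPeriod_of_multiplicative)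
    (hGZK : rank_eq_analyticRank_of_analyticRank_le_one) (hmod : hasEntireLFunction_rat)
    (W : WeierstrassCurve ℚ) [W.IsElliptic] [W.IsGloballyMinimal]
    (hWeq : W = ⟨0, -1, 0, -20373516, -45774812020⟩) (hr : W.analyticRank = 0) (hsurj : Surj W 5)
    (htam : W.tamagawaProduct = 10)
    {N : ℕ} [NeZero N] (D : ModularParametrizationData W N) (hc : ¬ (5 : ℤ) ∣ D.maninConstant)
    (hn : Kato.IsKolyvaginProduct W 5 2 1887751)
    (hcyc : ∀ (ℓ : ℕ) [Fact ℓ.Prime], ℓ ∣ 1887751 →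
      Nat.card {P : ((WeierstrassCurve.integralModelInt W).map
          (Int.castRingHom (ZMod ℓ))).toAffine.Point // 5 • P = 0} ≤ 5)
    (ψ : (ℓ : ℕ) → (ZMod ℓ)ˣ →* Multiplicative (ZMod (5 ^ 2)))
    (hψ : ∀ ℓ ∈ (1887751 : ℕ).primeFactors, Function.Surjective (ψ ℓ))
    (hδ : kuriharaNumber D.f (5 ^ 2) 1887751 ψ ≠ 0) : MissingLowerBoundAt W 5 := by
  haveI : Fact (Nat.Prime 5) := ⟨by norm_num⟩
  haveI : NeZero (1887751 : ℕ) := ⟨by norm_num⟩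
  have hX : ClassX11a W 5 := classX11a_k375440db1 W hWeq hr
  have hkc : 2 ≤ padicValNat 5 W.tamagawaProduct + 1 := by
    have h1 : 1 ≤ padicValNat 5 W.tamagawaProduct := by
      rw [htam]; exact one_le_padicValNat_of_dvd (by norm_num) (by norm_num)
    omega
  exact hX.missingLowerBoundAt_of_kimDeep_mult hKimM hϖ hGZK hmod le_rfl hsurj D hc
    2 1887751 (by norm_num) hkc hn hcyc ψ hψ hδ

/-- **`BSD(375440db1, 5)`** (`BSDp W 5`) from the same certificate: the lower half of `mlb5_k375440db1` plus the Euler half at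
surjective image (Wuthrich 2014 Prop. 21, `hWu`), through `ClassX11a.bsdp_of_kimDeep_mult`. Flag-free; PER PAIR;
nothing booked by this file. [cite: Wuthrich2014, Prop. 21 (p. 400)]
[cite: Kim2022StructureSelmer, Thm. 1.9 (6) (PDF p. 8), §3.2.1, Lemma 3.9, Thm. 3.13] [cite: Miller2011LMS, Def. 1.1]
[cite: Cremona2006, Table 1 (Cremona label 375440db1)] -/
theorem bsdp5_k375440db1 (hWu : sha_dvd_analyticSha)
    (hKimM : Kim2026.rankZero_le_padicValNat_sha_of_kuriharaNumber_ne_zero_of_splitMultiplicative_or_localTorsionTrivial)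
    (hϖ : realPeriodRat_eq_unit_mul_plusPeriod_of_multiplicative)
    (hGZK : rank_eq_analyticRank_of_analyticRank_le_one) (hmod : hasEntireLFunction_rat)
    (W : WeierstrassCurve ℚ) [W.IsElliptic] [W.IsGloballyMinimal]
    (hWeq : W = ⟨0, -1, 0, -20373516, -45774812020⟩) (hr : W.analyticRank = 0) (hsurj : Surj W 5)
    (htam : W.tamagawaProduct = 10)
    {N : ℕ} [NeZero N] (D : ModularParametrizationData W N) (hc : ¬ (5 : ℤ) ∣ D.maninConstant)
    (hn : Kato.IsKolyvaginProduct W 5 2 1887751)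
    (hcyc : ∀ (ℓ : ℕ) [Fact ℓ.Prime], ℓ ∣ 1887751 →
      Nat.card {P : ((WeierstrassCurve.integralModelInt W).map
          (Int.castRingHom (ZMod ℓ))).toAffine.Point // 5 • P = 0} ≤ 5)
    (ψ : (ℓ : ℕ) → (ZMod ℓ)ˣ →* Multiplicative (ZMod (5 ^ 2)))
    (hψ : ∀ ℓ ∈ (1887751 : ℕ).primeFactors, Function.Surjective (ψ ℓ))
    (hδ : kuriharaNumber D.f (5 ^ 2) 1887751 ψ ≠ 0) : BSDp W 5 := by
  haveI : Fact (Nat.Prime 5) := ⟨by norm_num⟩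
  haveI : NeZero (1887751 : ℕ) := ⟨by norm_num⟩
  have hX : ClassX11a W 5 := classX11a_k375440db1 W hWeq hr
  have hkc : 2 ≤ padicValNat 5 W.tamagawaProduct + 1 := by
    have h1 : 1 ≤ padicValNat 5 W.tamagawaProduct := by
      rw [htam]; exact one_le_padicValNat_of_dvd (by norm_num) (by norm_num)
    omega
  exact hX.bsdp_of_kimDeep_mult hWu hKimM hϖ hGZK hmod le_rfl hsurj D hc
    2 1887751 (by norm_num) hkc hn hcyc ψ hψ hδ

end Summit.BirchSwinnertonDyer.Rank1Residual.X11a.KimDeepClosures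

end
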